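import Summits.HodgeConjecture.HodgeConjecture.Theses.BoundaryReadout
import Summits.HodgeConjecture.HodgeConjecture.Theses.LinearSystemTorelli
import Summits.HodgeConjecture.HodgeConjecture.Theorems.LinearSystemTorelliMiddleDivisorSupportFourfoldStubDominantEnvelope
import Summits.HodgeConjecture.HodgeConjecture.Theorems.LinearSystemTorelliMiddleDivisorSupportFourfoldStubFiniteMonodromyOfTypeStability
import Literature.AlgebraicGeometry.HodgeTheory.ContinuationLoopsZariskiOpen
import Literature.AlgebraicGeometry.HodgeTheory.AlgebraicCyclesDefinedOverQbarSpread
import Literature.AlgebraicGeometry.HodgeTheory.HodgeConjectureQbarVoisin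
import Literature.AlgebraicGeometry.HodgeTheory.ComplexConjugationHolds
import Literature.AlgebraicGeometry.HodgeTheory.IsoTransport
import Literature.AlgebraicGeometry.FundamentalGroup.RiemannExistenceQbarDescentProofs
import Literature.AlgebraicGeometry.FundamentalGroup.RiemannExistenceSeparatingLowDim

/-!
# Line `generic-flatness` — crux `AbsoluteReduction` (stmt-HodgeConjecture-15945, route `BoundaryReadout`)
# through the `ℚ̄`-GENERIC FIBRE: absoluteness replaces the open transcendence kernel of Voisin's funnel

Strategist line (`crux-strategist`, alternative to `Lines/birth.lean`). The crux, BY NAME: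

  `BoundaryReadout.AbsoluteReduction := HCOverNumberFields → ∀ ⦃n X⦄, IsSmoothProjective n X →
     Nonempty (HodgeModel n X) ∧ ∀ p (c : H²ᵖ(X(ℂ); ℂ)), IsAbsoluteHodgeClass n X p c → c ∈ algebraicClasses X p`

(Voisin 2007 Prop. 1.2 = Charles–Schnell Thm. 11.3.19 for absolute classes; theorem in print).

## TRANSFER (the lens with teeth)

The sister crux `QbarEnvelope.Envelope` (stmt-HodgeConjecture-1069) has a kernel-checked road in the
tree (`Cruxes/Envelope/Lines/birth.lean`, itself transferred from `Cruxes/MiddleDivisorSupportFourfold/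
Lines/IdeatorFiveSketch.lean` v18): spread `X` out over `ℚ̄` with `X ≅ 𝒳_s`, `s` over the GENERIC
point of a smooth irreducible quasi-projective `ℚ̄`-base (`spreadingOut_smoothProjective_qbarFamily_holds`,
PROVED) ⟶ T: type stability of loop-continuations of the class at `s`, Zariski-locally on the base
(OPEN in general — it is where a counterexample to HC would live) ⟶ loop shrinking
(`IsContinuationAlong.exists_loop_forall_base_pt_notMem_of_qbarFamily`, PROVED) ⟶ finite monodromy
orbit (`Theorems.linearSystemTorelli_finite_setOf_isContinuationAlong_of_forall_isOfHodgeType`, PROVED: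
Hodge–Riemann for the relative hyperplane class + lattice finiteness) ⟶ B: dominant `ℚ̄`-envelope
`α = ι^* c'` (`Theorems.stub_dominantEnvelopeOfFiniteMonodromy`, PROVED modulo C = the smooth-affine
residual of Riemann's existence theorem and D = Deligne's partie fixe, item stmt-16363) ⟶ number-field
model (N) ⟶ HC over number fields ⟶ pull back (P = item stmt-1071).

**For an ABSOLUTE Hodge class the open kernel T is a THEOREM** (Charles–Schnell 2014, Thm. 11.3.15 (1)
and Cor. 11.3.16, cattani2014 pp. 485–487, READ; Voisin 2007 §2 p. 4: "a given Hodge class is absolute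
Hodge iff its `ℚ`-Zariski closure in `F^kH^{2k}` is contained in the locus of Hodge classes"): at a
`ℚ̄`-generic point `s`, an absolute class `α` on `𝒳_s = 𝒳_{η} ⊗_{ℚ̄(S₀), s} ℂ` is defined over a
FINITE extension `K'` of the function field `ℚ̄(S₀)` (Cor. 11.3.16 with `k` = the algebraic closure
of `ℚ̄(S₀)` in `ℂ`: the `Aut(ℂ/k)`-conjugates of `α` are `ℚ(p)`-rational classes of ONE variety, a
countable set, so the coefficients of `α` are algebraic over `k` — Baire); spreading `K'` to a finite
étale `S₀' → S₀ ∖ Z₀`, `α` extends to an algebraic de Rham section `α̃` over `S₀'` which is FLAT for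
Gauss–Manin (Thm. 11.3.15 (1): holomorphic coordinates taking values in a countable set on the dense
set of very general points are locally constant — Baire again) and whose value at any other point
`s''` over `s` is a conjugate `α̃(s'') = α̃(τ s') = α^τ` (`τ ∈ Aut(ℂ/ℚ̄)` carrying one generic point
of the irreducible `S₀'` to the other), hence `(2πi/τ(2πi))ᵖ ×` a rational `(p,p)` class by
absoluteness. A loop at `s` avoiding `Z₀` lifts to a path `s' ↝ s''` in `S₀'(ℂ)`; the continuation of
`α` along it is `α̃(s'')`, of type `(p,p)`. No Cattani–Deligne–Kaplan, no Principle B, no global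
invariant cycle theorem and no polarisation enter THIS step (they enter B, which is proved).

So the line is the Envelope road with T replaced by its absolute-class specialisation
`stub_typeStableOfAbsoluteAtQbarGeneric` (statement = T plus the hypothesis `IsAbsoluteHodgeClass`,
hence implied by T — `typeStableOfAbsolute_of_typeStable` below — and closing for free if stmt-1069's
kernel ever closes), plus the transport of absoluteness along the spreading isomorphism
(`stub_absoluteOfIso`, M: conjugation charts composed with an isomorphism), the three classical stubs
C, D, N VERBATIM from `Cruxes/Envelope/Lines/birth.lean` (one proof closes both lines; D is the route
item stmt-HodgeConjecture-16363 BY NAME) and P = the route item `BoundaryReadout.PullbackAlgebraic`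
(stmt-HodgeConjecture-1071) BY NAME — a hypothesis `closes` already carries.

## Why it dodges the hardest stub of `birth`

`birth.stub_absoluteSpread` asks to PRODUCE `(W over a number field, h : X ⟶ W, b)` with `h^* b = c`
— an existential over schemes whose witness needs, inside one stub, spreading + the `ℚ̄`-definability
of the Hodge locus of `c` + a `ℚ̄`-compactification + the global invariant cycle theorem + EGA
descent. Here the PRODUCTION of the envelope is the tree's proved mechanism B (+ C, D, N, shared
formalisation debts of three routes), and absoluteness is consumed by ONE property-stub (S2) about
continuations of `α` along loops at a `ℚ̄`-generic point — typed over existing carriers only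
(`IsContinuationAlong`, `fiberOver`, `IsAbsoluteHodgeClass`), no Hodge-locus / field-of-definition
vocabulary in the statement.

## Stubs (the ONLY sorries of the file)

* S1 `stub_absoluteOfIso` (M) — absoluteness transports along isomorphisms of smooth projective
  `ℂ`-schemes.
* S2 `stub_typeStableOfAbsoluteAtQbarGeneric` (L, LOAD-BEARING) — T for absolute classes.
* C `stub_locallyAlgebraicSeparatingSmoothAffineDimGeTwo` (L, classical; verbatim Envelope-birth C /
  IdeatorFiveSketch C1''').
* D `stub_deligneGlobalInvariantCycles` (L–XL, classical) = item stmt-16363 by name.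
* N `stub_numberFieldModel` (M, classical; verbatim Envelope-birth N).
* P `stub_pullbackAlgebraic` (M, classical) = item stmt-1071 by name (as in `birth`).

`AbsoluteReduction_of (S1) (S2) (C) (D) (N) (P) : BoundaryReadout.AbsoluteReduction` — kernel-checked,
no `sorry`; `AbsoluteReduction_of_stubs` feeds the stubs in.

Disproof used: none exists for this crux (`disproof_path` absent, no `Cruxes/AbsoluteReduction/Disproof.lean`,
no `Negative/`); refuter rattack-15945-0 (2026-08-17): crux HC-safe (`HodgeConjecture → AbsoluteReduction`
kernel-checked), no stub here is an instance of the three refuted statements of the negatives index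
(MilnorK symbol lift, Fermat–K3 multisets, E-line matrices).

References: C. Voisin, *Hodge loci and absolute Hodge classes*, Compositio 143 (2007) =
arXiv:math/0605766, Def. 1.1, Prop. 1.2, §2 p. 4, §3 p. 6–7 [Voisin2007HodgeLoci]; F. Charles,
C. Schnell, *Notes on absolute Hodge classes*, in cattani2014, Prop. 11.3.13, Lemma 11.3.14,
Thm. 11.3.15, Cor. 11.3.16, Thm. 11.3.17, Thm. 11.3.19 [CharlesSchnell2014Notes]; P. Deligne,
*Hodge cycles on abelian varieties*, LNM 900, Prop. 2.9, Thm. 2.12 [Deligne1982HodgeCycles];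
SGA1 XII Thm. 5.1; Deligne, Hodge II Thm. 4.1.1 [DeligneHodgeII1971]; EGA IV₃ 8.8.2;
Fulton, *Intersection theory* Cor. 19.2 [Fulton1998].
-/

set_option linter.dupNamespace false

namespace Summit.HodgeConjecture.HodgeConjecture.Cruxes.AbsoluteReduction.GenericFlatness

open CategoryTheory AlgebraicGeometry Topology
open Literature.AlgebraicGeometry Literature.AlgebraicGeometry.Motives
open Literature.AlgebraicGeometry.HodgeTheory
open Literature.AlgebraicTopology.SingularHomology
open Summit.HodgeConjecture.HodgeConjecture.Theses

/-! ## §1 Registered stubs (`theorem stub_<name> : <signature> := by sorry` — the ONLY sorries) -/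

/-- **S1 (M) — absolute Hodge classes transport along isomorphisms.** For an isomorphism
`e : X' ≅ X` of smooth projective `ℂ`-schemes of dimension `n` and an absolute Hodge class `c` on
`X`, the class `e^* c` is absolute Hodge on `X'`. Road: rationality and Hodge type transport
(`isRationalClass_map_iff_of_iso`, `isOfHodgeType_map_iff_of_iso`, PROVED, `IsoTransport`); a
conjugation chart `(Y, π, …)` for `X` gives the chart `(Y, π ≫ e⁻¹, …)` for `X'` with the same affine
`Y`, analytic models and de Rham family (`conjHom σ` is a functor, so `(e⁻¹)^σ` is an isomorphism and
injectivity of `((π ≫ e⁻¹)^σ)^*` follows), and conversely; in these charts `c' ↦ ((e.hom)^σ)^* c'`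
matches the conjugates of `c` with those of `e^* c`, and `periodTwist σ p • β ↦ periodTwist σ p • (e^σ)^* β`
with `(e^σ)^* β` rational `(p,p)` on `X'^σ`. Why it might fail: only by mis-typing (both directions of
the `∃ c'`/`∀ c'` clauses of `IsAbsoluteHodgeClass` must be transported; the `∀` clause uses a chart
of `X'` NOT of the form above, handled by the converse construction).
[CharlesSchnell2014Notes Def. 11.2.3, §11.2.2 (11.2.1)–(11.2.3); Jouanolou1973 Lemme 1.5] -/
theorem stub_absoluteOfIso :
    ∀ ⦃n : ℕ⦄ ⦃X X' : SchemeOver ℂ⦄ (e : X' ≅ X), IsSmoothProjective n X → IsSmoothProjective n X' →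
      ∀ (p : ℕ) (c : complexBetti X (2 * p)), IsAbsoluteHodgeClass n X p c →
        IsAbsoluteHodgeClass n X' p (complexBetti.map e.hom (2 * p) c) := by
  sorry

/-- **S2 (L, LOAD-BEARING) — type stability at `ℚ̄`-generic points FOR ABSOLUTE CLASSES,
Zariski-locally on the base** (the registered open kernel T of `Cruxes/Envelope/Lines/birth.lean`,
`stub_typeStabilityAtQbarGenericZariskiLocal`, with the hypothesis "`α` rational of type `(p,p)`"
strengthened to "`α` absolute Hodge" — so T ⟹ S2, `typeStableOfAbsolute_of_typeStable`). For
`σ : ℚ̄ →+* ℂ`, a `ℚ̄`-morphism `f₀ : 𝒳₀ ⟶ S₀` of quasi-projective `ℚ̄`-schemes with `S₀` smooth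
irreducible whose complexification is a smooth projective family of relative dimension `n`, a
complex point `s` over the GENERIC point of `S₀` and an ABSOLUTE Hodge class `α` on the fibre `𝒳_s`:
there is a proper Zariski-closed `Z₀ ⊊ S₀` such that every flat continuation `β` of `α` along a loop
at `s` lying over `S₀ ∖ Z₀` is of type `(p,p)`. THEOREM IN PRINT (content): Charles–Schnell
Cor. 11.3.16 (an absolute class on `X_ℂ`, `X` over an algebraically closed `k ⊂ ℂ`, is defined over
`k`; here `k` = algebraic closure of `ℚ̄(S₀)` embedded by `s`, so `α` is defined over a finite
extension `K'` of the function field) + Thm. 11.3.15 (1) (the algebraic extension `α̃` of `α` over a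
finite étale `S₀' → S₀ ∖ Z₀` is FLAT — Baire — and its values at the points `s''` over `s` are the
conjugates `α^τ`, `τ ∈ Aut(ℂ/ℚ̄)` with `τ s' = s''`, hence `periodTwist • ` rational `(p,p)` by
absoluteness); a loop over `S₀ ∖ Z₀` lifts to `S₀'(ℂ)` and the continuation of `α` is `α̃(s'')`.
Equivalently (Voisin 2007 §2): the `ℚ̄`-Zariski closure of `(s, (2πi)ᵖα)` in `F^pℋ^{2p}_{dR}` lies in
the locus of Hodge classes and is generically finite over `S₀`. Why it might fail: not by mathematics
(theorem in print) but by the DICTIONARY: the tree's `IsAbsoluteHodgeClass` reads conjugates through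
affine conjugation charts (`ConjugationChart`), and the proof needs (i) charts compatible with the
`ℚ̄`-structure of the family (`(𝒳_s)^τ ≅ 𝒳_{τ s}` and `α̃(τ s) = α̃(s)^τ`), (ii) flat algebraic de Rham
sections = continuous sections of `FiberClass` (Gauss–Manin vs the étalé topology), (iii) automorphism
extension `Aut(ℂ/ℚ̄) ∋ τ`, `τ s' = s''` (tree: `FieldTheory.AlgClosed.AutomorphismExtension`); a
normalisation slip between the untwisted lattice and `ℚ(p)` would show as a spurious `periodTwist`.
[CharlesSchnell2014Notes Thm. 11.3.15 (1), Cor. 11.3.16, Prop. 11.3.13, Lemma 11.3.14 (cattani2014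
pp. 484–487); Voisin2007HodgeLoci §2 p. 4, Lemma 2.4; Deligne1982HodgeCycles Prop. 2.9] -/
theorem stub_typeStableOfAbsoluteAtQbarGeneric :
    ∀ (σ : AlgebraicClosure ℚ →+* ℂ) ⦃𝒳₀ S₀ : SchemeOver (AlgebraicClosure ℚ)⦄ (f₀ : 𝒳₀ ⟶ S₀)
      (n p : ℕ), IsQuasiProjectiveOver 𝒳₀ → IsQuasiProjectiveOver S₀ → IrreducibleSpace S₀.left →
      AlgebraicGeometry.Smooth S₀.hom → IsSmoothProjectiveFamily ((baseChangeHom σ).map f₀) n →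
      ∀ (s : ComplexPoints ((baseChangeHom σ).obj S₀)),
        closure {(baseChangeHomFst σ S₀).base s.pt} = (Set.univ : Set S₀.left) →
        ∀ (α : complexBetti (fiberOver ((baseChangeHom σ).map f₀) s) (2 * p)),
          IsAbsoluteHodgeClass n (fiberOver ((baseChangeHom σ).map f₀) s) p α →
          ∃ Z₀ : Set S₀.left, IsClosed Z₀ ∧ Z₀ ≠ Set.univ ∧
            ∀ (γ : Path s s), (∀ u, (baseChangeHomFst σ S₀).base (γ u).pt ∉ Z₀) →
              ∀ (β : complexBetti (fiberOver ((baseChangeHom σ).map f₀) s) (2 * p)),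
                IsContinuationAlong γ α β →
                  IsOfHodgeType n (fiberOver ((baseChangeHom σ).map f₀) s) (2 * p) p p β := by
  sorry

/-- **C (L, classical) — locally algebraic separating functions on finite coverings of smooth
irreducible affine `ℂ`-schemes of relative dimension `≥ 2`** (the open residual of RIEMANN'S
EXISTENCE THEOREM in the tree): VERBATIM the registered stub C of `Cruxes/Envelope/Lines/birth.lean`
and C1''' of `Cruxes/MiddleDivisorSupportFourfold/Lines/IdeatorFiveSketch.lean` (one proof closes all
three lines). For every smooth irreducible AFFINE `ℂ`-scheme `S` of relative dimension `n + 2`, every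
covering map `q : T → S(ℂ)` with finite fibres and every `P₀ ∈ S(ℂ)`: an affine open `U ∋ P₀`, a
function `h : T → ℂ` continuous on `q⁻¹(U(ℂ))` and injective on `q⁻¹(P₀)`, and a NON-ZERO
`F ∈ Γ(S, U)[τ]` with `F(q t)(h t) = 0` whenever `q t ∈ U(ℂ)`. Why it might fail: only by
mis-typing — it is SGA1 XII Thm. 5.1 (Grauert–Remmert / GAGA); the risk is size.
[SGA1 Exp. XII Thm. 5.1; GrauertRemmert1958; SerreGAGA1956] -/
theorem stub_locallyAlgebraicSeparatingSmoothAffineDimGeTwo :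
    ∀ (n : ℕ) (S : SchemeOver ℂ), IsAffine S.left → SmoothOfRelativeDimension (n + 2) S.hom →
      IrreducibleSpace S.left →
      ∀ (T : Type) [TopologicalSpace T] (q : T → ComplexPoints S) (_ : IsCoveringMap q)
        (_ : ∀ t, (q ⁻¹' {t}).Finite) (P₀ : ComplexPoints S),
        ∃ (U : S.left.Opens) (_ : IsAffineOpen U) (_ : P₀.pt ∈ U) (h : T → ℂ)
          (F : Polynomial Γ(S.left, U)),
          ContinuousOn h (q ⁻¹' {P | P.pt ∈ U}) ∧ F ≠ 0 ∧
          (∀ (t : T) (ht : (q t).pt ∈ U), (F.map ((q t).evalRingHom U ht)).eval (h t) = 0) ∧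
          Set.InjOn h (q ⁻¹' {P₀}) := by
  sorry

/-- **D (L–XL, classical) — Deligne's global invariant cycle theorem (théorème de la partie fixe),
as the EXISTING route item stmt-HodgeConjecture-16363 BY NAME**
(`Theses.LinearSystemTorelli.DeligneGlobalInvariantCycles`; `Iff.rfl` with the named fact
`deligne_globalInvariantCycles`, `deligneGlobalInvariantCycles_iff`). Why it might fail: a 1971
theorem — only its size (Leray degeneration + Hodge II MHS); closes by
`exact LinearSystemTorelli.DeligneGlobalInvariantCycles_holds` the moment that item closes.
[DeligneHodgeII1971 Thm. 4.1.1; VoisinHodgeII2003 Prop. 4.23, Thm. 4.24; CharlesSchnell2014Notes Thm. 11.3.4] -/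
theorem stub_deligneGlobalInvariantCycles :
    Summit.HodgeConjecture.HodgeConjecture.Theses.LinearSystemTorelli.DeligneGlobalInvariantCycles := by
  sorry

/-- **N (M, classical) — smooth projective `ℚ̄`-schemes are defined over number fields**
(EGA IV₃ 8.8.2 (ii)): VERBATIM the registered stub N of `Cruxes/Envelope/Lines/birth.lean`. Road:
`Limits.exists_isPullback_specMap_subalgebra` (PROVED: a model over a finitely generated
`ℚ`-subalgebra `R ⊆ ℚ̄`), and `R` — an integral domain, finitely generated and algebraic over `ℚ` — is
a number field. Why it might fail: only by mis-typing (the isomorphism is asked OVER `ℚ̄`, which the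
cartesian square gives). [EGAIV3 Thm. 8.8.2 (ii); GortzWedhorn2020 Thm. 10.66, Prop. 10.75] -/
theorem stub_numberFieldModel :
    ∀ ⦃m : ℕ⦄ (W₀ : SchemeOver (AlgebraicClosure ℚ)), IsSmoothProjective m W₀ →
      ∃ (K : Type) (_ : Field K) (_ : NumberField K) (ι : K →+* AlgebraicClosure ℚ)
        (W₁ : SchemeOver K), Nonempty (W₀ ≅ (baseChangeHom ι).obj W₁) := by
  sorry

/-- **P (M, classical) — pull-back preserves algebraic classes**: VERBATIM the route's open item
`BoundaryReadout.PullbackAlgebraic` (stmt-HodgeConjecture-1071; `@[route_item]`, shared with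
`QbarEnvelope`, a hypothesis of `closes`), by name — for `ι : X ⟶ W` a `ℂ`-morphism of smooth
projective varieties, `ι^*(Nᵖ H²ᵖ(W(ℂ); ℂ)) ⊆ Nᵖ H²ᵖ(X(ℂ); ℂ)`; the route-shaped corollary
`fulton1998_map_mem_algebraicClasses.pullbackAlgebraic` of the Literature named fact.
[Fulton1998 Cor. 19.2 (b), §19.1 Lemma 19.1.1; VoisinHodgeII2003 Prop. 9.21 (i)] -/
theorem stub_pullbackAlgebraic : BoundaryReadout.PullbackAlgebraic := by
  sorry

/-- P from the Literature named fact `fulton1998_map_mem_algebraicClasses` (binder reordering). -/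
example (h : fulton1998_map_mem_algebraicClasses) : BoundaryReadout.PullbackAlgebraic :=
  h.pullbackAlgebraic

/-! ## §2 Stub statements by name: `Sig.stub_<name> : Prop`

(As in `Lines/birth.lean`: each restatement is the stub's type verbatim, pinned by a defeq `example`;
`#h21_check_skeleton` then admits it as a hypothesis of `AbsoluteReduction_of` by its last name
component. D and P are route items, admitted by name.) -/

/-- Statement of `stub_absoluteOfIso`, verbatim. -/
def Sig.stub_absoluteOfIso : Prop :=
  ∀ ⦃n : ℕ⦄ ⦃X X' : SchemeOver ℂ⦄ (e : X' ≅ X), IsSmoothProjective n X → IsSmoothProjective n X' →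
    ∀ (p : ℕ) (c : complexBetti X (2 * p)), IsAbsoluteHodgeClass n X p c →
      IsAbsoluteHodgeClass n X' p (complexBetti.map e.hom (2 * p) c)

/-- Statement of `stub_typeStableOfAbsoluteAtQbarGeneric`, verbatim. -/
def Sig.stub_typeStableOfAbsoluteAtQbarGeneric : Prop :=
  ∀ (σ : AlgebraicClosure ℚ →+* ℂ) ⦃𝒳₀ S₀ : SchemeOver (AlgebraicClosure ℚ)⦄ (f₀ : 𝒳₀ ⟶ S₀)
    (n p : ℕ), IsQuasiProjectiveOver 𝒳₀ → IsQuasiProjectiveOver S₀ → IrreducibleSpace S₀.left →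
    AlgebraicGeometry.Smooth S₀.hom → IsSmoothProjectiveFamily ((baseChangeHom σ).map f₀) n →
    ∀ (s : ComplexPoints ((baseChangeHom σ).obj S₀)),
      closure {(baseChangeHomFst σ S₀).base s.pt} = (Set.univ : Set S₀.left) →
      ∀ (α : complexBetti (fiberOver ((baseChangeHom σ).map f₀) s) (2 * p)),
        IsAbsoluteHodgeClass n (fiberOver ((baseChangeHom σ).map f₀) s) p α →
        ∃ Z₀ : Set S₀.left, IsClosed Z₀ ∧ Z₀ ≠ Set.univ ∧
          ∀ (γ : Path s s), (∀ u, (baseChangeHomFst σ S₀).base (γ u).pt ∉ Z₀) →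
            ∀ (β : complexBetti (fiberOver ((baseChangeHom σ).map f₀) s) (2 * p)),
              IsContinuationAlong γ α β →
                IsOfHodgeType n (fiberOver ((baseChangeHom σ).map f₀) s) (2 * p) p p β

/-- Statement of `stub_locallyAlgebraicSeparatingSmoothAffineDimGeTwo`, verbatim. -/
def Sig.stub_locallyAlgebraicSeparatingSmoothAffineDimGeTwo : Prop :=
  ∀ (n : ℕ) (S : SchemeOver ℂ), IsAffine S.left → SmoothOfRelativeDimension (n + 2) S.hom →
    IrreducibleSpace S.left →
    ∀ (T : Type) [TopologicalSpace T] (q : T → ComplexPoints S) (_ : IsCoveringMap q)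
      (_ : ∀ t, (q ⁻¹' {t}).Finite) (P₀ : ComplexPoints S),
      ∃ (U : S.left.Opens) (_ : IsAffineOpen U) (_ : P₀.pt ∈ U) (h : T → ℂ)
        (F : Polynomial Γ(S.left, U)),
        ContinuousOn h (q ⁻¹' {P | P.pt ∈ U}) ∧ F ≠ 0 ∧
        (∀ (t : T) (ht : (q t).pt ∈ U), (F.map ((q t).evalRingHom U ht)).eval (h t) = 0) ∧
        Set.InjOn h (q ⁻¹' {P₀})

/-- Statement of `stub_numberFieldModel`, verbatim. -/
def Sig.stub_numberFieldModel : Prop :=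
  ∀ ⦃m : ℕ⦄ (W₀ : SchemeOver (AlgebraicClosure ℚ)), IsSmoothProjective m W₀ →
    ∃ (K : Type) (_ : Field K) (_ : NumberField K) (ι : K →+* AlgebraicClosure ℚ)
      (W₁ : SchemeOver K), Nonempty (W₀ ≅ (baseChangeHom ι).obj W₁)

example : Sig.stub_absoluteOfIso := stub_absoluteOfIso
example : Sig.stub_typeStableOfAbsoluteAtQbarGeneric := stub_typeStableOfAbsoluteAtQbarGeneric
example : Sig.stub_locallyAlgebraicSeparatingSmoothAffineDimGeTwo :=
  stub_locallyAlgebraicSeparatingSmoothAffineDimGeTwo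
example : Sig.stub_numberFieldModel := stub_numberFieldModel

/-! ## §3 Sorry-free links (tree theorems only) -/

/-- **T ⟹ S2**: the registered open kernel T of the Envelope road (type stability for ALL rational
`(p,p)` classes at `ℚ̄`-generic points) gives S2, since an absolute Hodge class is rational of type
`(p,p)` (`IsAbsoluteHodgeClass.1/.2.1`). Records the dedup: S2 is the absolute-class SPECIAL CASE of
stmt-1069's kernel, and a theorem in print. -/
theorem typeStableOfAbsolute_of_typeStable
    (hT : ∀ (σ : AlgebraicClosure ℚ →+* ℂ) ⦃𝒳₀ S₀ : SchemeOver (AlgebraicClosure ℚ)⦄ (f₀ : 𝒳₀ ⟶ S₀)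
      (n p : ℕ), IsQuasiProjectiveOver 𝒳₀ → IsQuasiProjectiveOver S₀ → IrreducibleSpace S₀.left →
      AlgebraicGeometry.Smooth S₀.hom → IsSmoothProjectiveFamily ((baseChangeHom σ).map f₀) n →
      ∀ (s : ComplexPoints ((baseChangeHom σ).obj S₀)),
        closure {(baseChangeHomFst σ S₀).base s.pt} = (Set.univ : Set S₀.left) →
        ∀ (α : complexBetti (fiberOver ((baseChangeHom σ).map f₀) s) (2 * p)),
          IsRationalClass α → IsOfHodgeType n (fiberOver ((baseChangeHom σ).map f₀) s) (2 * p) p p α →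
          ∃ Z₀ : Set S₀.left, IsClosed Z₀ ∧ Z₀ ≠ Set.univ ∧
            ∀ (γ : Path s s), (∀ u, (baseChangeHomFst σ S₀).base (γ u).pt ∉ Z₀) →
              ∀ (β : complexBetti (fiberOver ((baseChangeHom σ).map f₀) s) (2 * p)),
                IsContinuationAlong γ α β →
                  IsOfHodgeType n (fiberOver ((baseChangeHom σ).map f₀) s) (2 * p) p p β) :
    Sig.stub_typeStableOfAbsoluteAtQbarGeneric :=
  fun σ _ _ f₀ n p h𝒳₀ hS₀ hirr hsm hf s hgen α hα ↦
    hT σ f₀ n p h𝒳₀ hS₀ hirr hsm hf s hgen α hα.1 hα.2.1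

/-- **S2 ⟹ global type stability at `ℚ̄`-generic points for absolute classes** (the tree's
loop-shrinking theorem `IsContinuationAlong.exists_loop_forall_base_pt_notMem_of_qbarFamily`: a
continuation along some loop at the `ℚ̄`-generic `s` is a continuation along a loop over `S₀ ∖ Z₀`). -/
theorem typeStabilityOfAbsolute_of_zariskiLocal (hT : Sig.stub_typeStableOfAbsoluteAtQbarGeneric)
    (σ : AlgebraicClosure ℚ →+* ℂ) ⦃𝒳₀ S₀ : SchemeOver (AlgebraicClosure ℚ)⦄ (f₀ : 𝒳₀ ⟶ S₀)
    (n p : ℕ) (h𝒳₀ : IsQuasiProjectiveOver 𝒳₀) (hS₀ : IsQuasiProjectiveOver S₀)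
    (hirr : IrreducibleSpace S₀.left) (hsm : AlgebraicGeometry.Smooth S₀.hom)
    (hf : IsSmoothProjectiveFamily ((baseChangeHom σ).map f₀) n)
    (s : ComplexPoints ((baseChangeHom σ).obj S₀))
    (hgen : closure {(baseChangeHomFst σ S₀).base s.pt} = (Set.univ : Set S₀.left))
    (α : complexBetti (fiberOver ((baseChangeHom σ).map f₀) s) (2 * p))
    (hα : IsAbsoluteHodgeClass n (fiberOver ((baseChangeHom σ).map f₀) s) p α) :
    ∀ (γ : Path s s) (β : complexBetti (fiberOver ((baseChangeHom σ).map f₀) s) (2 * p)),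
      IsContinuationAlong γ α β →
        IsOfHodgeType n (fiberOver ((baseChangeHom σ).map f₀) s) (2 * p) p p β := by
  intro γ β hγ
  obtain ⟨Z₀, hZ₀, hZ₀', H⟩ := hT σ f₀ n p h𝒳₀ hS₀ hirr hsm hf s hgen α hα
  haveI := hirr
  haveI := hsm
  obtain ⟨γ', hγ', hc⟩ :=
    IsContinuationAlong.exists_loop_forall_base_pt_notMem_of_qbarFamily σ f₀ (2 * p) hS₀ hf hZ₀ hZ₀'
      hgen hγ
  exact H γ' hγ' β hc

/-- **C ⟹ the named fact `FundamentalGroup.riemannExistence_qbarDescent_of_finiteIndex`** (relative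
dimension `≤ 1` is the tree's `algebraicSeparating_of_smoothOfRelativeDimension_le_one`, dimension
`≥ 2` is C, and `…_of_locallyAlgebraicSeparating` — Theorems A/B′, Zariski-local gluing, weak descent,
all PROVED — concludes). Copied from `Cruxes/Envelope/Lines/birth.lean`. -/
theorem riemannExistenceQbarDescent_of_locallyAlgebraicSeparatingDimGeTwo
    (hC : Sig.stub_locallyAlgebraicSeparatingSmoothAffineDimGeTwo) :
    Literature.AlgebraicGeometry.FundamentalGroup.riemannExistence_qbarDescent_of_finiteIndex := by
  refine Literature.AlgebraicGeometry.FundamentalGroup.riemannExistence_qbarDescent_of_finiteIndex_of_locallyAlgebraicSeparating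
    fun S hS hsm hirr T _ q hq hfin P₀ ↦ ?_
  haveI := hS
  haveI := hsm
  haveI := hirr
  obtain ⟨n, hn⟩ := Motives.exists_smoothOfRelativeDimension_of_smooth S.hom
  rcases Nat.lt_or_ge n 2 with hlt | hge
  · obtain ⟨h, F, hh, hF, hroot, hinj⟩ :=
      Literature.AlgebraicGeometry.FundamentalGroup.algebraicSeparating_of_smoothOfRelativeDimension_le_one
        (Nat.lt_succ_iff.mp hlt) S q hq hfin P₀
    exact ⟨⊤, isAffineOpen_top S.left, trivial, h, F, hh.continuousOn, hF, fun t _ ↦ hroot t, hinj⟩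
  · obtain ⟨m, rfl⟩ := Nat.exists_eq_add_of_le' hge
    exact hC m S hS hn hirr T q hq hfin P₀

/-- The route decl of stmt-16363 IS the named fact `deligne_globalInvariantCycles`: `Iff.rfl`. -/
theorem deligneGlobalInvariantCycles_iff :
    Summit.HodgeConjecture.HodgeConjecture.Theses.LinearSystemTorelli.DeligneGlobalInvariantCycles ↔
      deligne_globalInvariantCycles :=
  Iff.rfl

/-- **Transitivity of base change**: `(X_φ)_σ ≅ X_{σ ∘ φ}` (Mathlib `Over.pullbackComp`). Copied from
`Cruxes/Envelope/Lines/birth.lean`. -/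
theorem nonempty_iso_baseChangeHom_comp {k L M : Type} [CommRing k] [CommRing L] [CommRing M]
    (φ : k →+* L) (σ : L →+* M) (X : SchemeOver k) :
    Nonempty ((baseChangeHom σ).obj ((baseChangeHom φ).obj X) ≅ (baseChangeHom (σ.comp φ)).obj X) := by
  have h : Spec.map (CommRingCat.ofHom (σ.comp φ)) =
      Spec.map (CommRingCat.ofHom σ) ≫ Spec.map (CommRingCat.ofHom φ) := by
    rw [CommRingCat.ofHom_comp, Spec.map_comp]
  refine ⟨((CategoryTheory.Over.pullbackComp (Spec.map (CommRingCat.ofHom σ))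
      (Spec.map (CommRingCat.ofHom φ))).app X).symm ≪≫ CategoryTheory.eqToIso ?_⟩
  change (CategoryTheory.Over.pullback _).obj X = (CategoryTheory.Over.pullback _).obj X
  rw [h]

/-! ## §4 Composition: the stubs conclude the crux BY NAME -/

/-- **Assembly, implication form** (kernel-checked, no `sorry`): S1 → S2 → C → D → N → P →
`BoundaryReadout.AbsoluteReduction`. Given `HCOverNumberFields`, `X` smooth projective and an
absolute class `c`: the Hodge-model conjunct is the tree theorem `nonempty_hodgeModel_holds`; fix
`σ : ℚ̄ →+* ℂ`; spread `X` out (`e : X ≅ 𝒳_s`, `s` `ℚ̄`-generic — PROVED); `(e⁻¹)^* c` is absolute on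
`𝒳_s` (S1), hence type-stable along loops (S2 + loop shrinking), hence of FINITE monodromy orbit
(Hodge–Riemann + lattice finiteness, PROVED); Voisin's mechanism B (PROVED) fed with C and D writes
`(e⁻¹)^* c = ι^* c'`, `c'` rational `(p,p)` on a smooth projective `W₀ ⊗_σ ℂ`; `W₀` is smooth
projective over `ℚ̄` (`isSmoothProjective_of_baseChangeHom`, PROVED), N gives a number-field model
`W₀ ⊗_σ ℂ ≅ W₁ ⊗_{K, σ∘ι₀} ℂ`, so `HCOverNumberFields` makes `c'` algebraic; P pulls algebraicity
back along `ι` and along `e.hom`, and `e^* (e⁻¹)^* c = c`. [Voisin2007HodgeLoci Prop. 1.2;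
CharlesSchnell2014Notes Thm. 11.3.15, Cor. 11.3.16, Thm. 11.3.19] -/
theorem AbsoluteReduction_of (hI : Sig.stub_absoluteOfIso)
    (hT : Sig.stub_typeStableOfAbsoluteAtQbarGeneric)
    (hC : Sig.stub_locallyAlgebraicSeparatingSmoothAffineDimGeTwo)
    (hD : Summit.HodgeConjecture.HodgeConjecture.Theses.LinearSystemTorelli.DeligneGlobalInvariantCycles)
    (hN : Sig.stub_numberFieldModel) (hP : BoundaryReadout.PullbackAlgebraic) :
    Summit.HodgeConjecture.HodgeConjecture.Theses.BoundaryReadout.AbsoluteReduction := by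
  unfold Summit.HodgeConjecture.HodgeConjecture.Theses.BoundaryReadout.AbsoluteReduction
  intro hQ n X hX
  -- conjunct 1: a Hodge model exists (tree theorem); conjunct 2: absolute ⇒ algebraic
  refine ⟨nonempty_hodgeModel_holds hX, fun p c hc ↦ ?_⟩
  -- an embedding `σ : ℚ̄ →+* ℂ`
  obtain ⟨σ⟩ := exists_ringHom_algebraicClosure_rat_complex
  -- spread `X` out over `ℚ̄`: `e : X ≅ 𝒳_s`, `s` over the generic point of the smooth irreducible `S₀`
  obtain ⟨𝒳₀, S₀, f₀, s, h𝒳₀, hS₀, hirr, hsm, hf, hgen, ⟨e⟩⟩ :=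
    spreadingOut_smoothProjective_qbarFamily_holds σ hX
  have hXs : IsSmoothProjective n (fiberOver ((baseChangeHom σ).map f₀) s) := hf.isSmoothProjective s
  -- S1: the transported class `(e⁻¹)^* c` is absolute Hodge on the fibre
  have habs : IsAbsoluteHodgeClass n (fiberOver ((baseChangeHom σ).map f₀) s) p
      (complexBetti.map e.inv (2 * p) c) := hI e.symm hX hXs p c hc
  -- S2 + loop shrinking: type stability; then finite monodromy orbit (unconditional in the tree)
  have hfin := Theorems.linearSystemTorelli_finite_setOf_isContinuationAlong_of_forall_isOfHodgeType σ
    f₀ n p hf h𝒳₀ hS₀ hirr hsm s (complexBetti.map e.inv (2 * p) c) habs.1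
    (typeStabilityOfAbsolute_of_zariskiLocal hT σ f₀ n p h𝒳₀ hS₀ hirr hsm hf s hgen
      (complexBetti.map e.inv (2 * p) c) habs)
  -- Voisin's mechanism B (PROVED), fed with C (Riemann existence) and D (partie fixe)
  obtain ⟨m, W₀, ι, c', hW, -, hc', hh', hmap⟩ :=
    Theorems.stub_dominantEnvelopeOfFiniteMonodromy
      (riemannExistenceQbarDescent_of_locallyAlgebraicSeparatingDimGeTwo hC)
      (deligneGlobalInvariantCycles_iff.1 hD) σ f₀ n p h𝒳₀ hS₀ hirr hsm hf s hgen
      (complexBetti.map e.inv (2 * p) c) habs.1 habs.2.1 hfin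
  -- `W₀` is smooth projective over `ℚ̄`, so it has a number-field model (N); HC over number fields
  obtain ⟨K, hK, hKn, ι₀, W₁, ⟨e₁⟩⟩ := hN W₀ (isSmoothProjective_of_baseChangeHom σ W₀ hW)
  obtain ⟨e₂⟩ := nonempty_iso_baseChangeHom_comp ι₀ σ W₁
  have hHC : HodgeConjectureFor m ((baseChangeHom σ).obj W₀) :=
    hQ hW ⟨K, hK, hKn, σ.comp ι₀, W₁, ⟨(baseChangeHom σ).mapIso e₁ ≪≫ e₂⟩⟩
  have halg' : c' ∈ algebraicClasses ((baseChangeHom σ).obj W₀) p := hHC.2 p c' hc' hh'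
  -- P: pull back along `ι`, then along `e.hom`
  have halg : complexBetti.map e.inv (2 * p) c ∈
      algebraicClasses (fiberOver ((baseChangeHom σ).map f₀) s) p := by
    rw [← hmap]
    exact hP hXs hW ι p c' halg'
  have key := hP hX hXs e.hom p _ halg
  rwa [e.complexBetti_map_hom_map_inv] at key

/-- **The crux from its registered stubs, by name** (no `sorry` of its own; its closure is
conditional on the six `stub_*` placeholders until they are proved). -/
theorem AbsoluteReduction_of_stubs :
    Summit.HodgeConjecture.HodgeConjecture.Theses.BoundaryReadout.AbsoluteReduction :=
  AbsoluteReduction_of stub_absoluteOfIso stub_typeStableOfAbsoluteAtQbarGeneric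
    stub_locallyAlgebraicSeparatingSmoothAffineDimGeTwo stub_deligneGlobalInvariantCycles
    stub_numberFieldModel stub_pullbackAlgebraic

end Summit.HodgeConjecture.HodgeConjecture.Cruxes.AbsoluteReduction.GenericFlatness
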